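import Summits.CriticalPhenomena.PercolationContinuityZ3.Theorems.PercNearOneGluingNoHeavyLowerTailNineTypeCube

/-!
# Nine-type programme for `Q44b`: the cube detector with arbitrary low members (types `1,…,7`)

Support file for crux `stmt-CriticalPhenomena-4575` (`Q44b`, GF(2)-rank line of `prim-bnk-1`), seat `prim-bnk-1` gen 19;
memo `run/shared/lean/prim/prim-l12/FROM-prim-bnk-1-gen19-HALL-GRAM-ASSEMBLY.md` §13–§14.

`…NineTypeCube` proved the two properties of the cube detector of an H-dependency `Z ⊔ A` (`A` = types 8/9) for `Z`-types in
`{3,…,7}`.  Here the SAME statements are proved for `Z`-types in `{1,…,7}`: in the two places where the HL-table fails for a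
member `z` of type 1 or 2 against a point `s` of type 5/6/7 (`hlOK (θ s) (θ z) = false`), the good point is supplied by the
ANCHOR instead — `a ∪ zᶜ` (`hlOK 8 1 = hlOK 8 2 = true`) resp. `s ∪ z'ᶜ` for `s` of type 8/9 — and these are contained in the
same target `s ∪ a` resp. `s ∪ z`.  With this the nine-type count needs no type restriction at all (`…NineTypeCount`).
Pure finite combinatorics; no named facts, no sorries, standard axioms.
-/

namespace Summit.CriticalPhenomena.PercolationContinuityZ3.Theorems

namespace NineType

open Finset

variable {α : Type*} [DecidableEq α] [Fintype α]

/-- Table fact: an anchor (type 8/9) is HL-compatible with every non-free low type `1,2,3,4,6`. -/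
theorem hlOK_anchor_low (x z : ℕ) (hx : x = 8 ∨ x = 9) (hz : 1 ≤ z ∧ z ≤ 7) (hnf : ¬ (z = 5 ∨ z = 7)) :
    hlOK x z = true := by
  rcases hz with ⟨h1, h7⟩
  rcases hx with rfl | rfl <;> interval_cases z <;> simp_all (config := {decide := true})

/-- **Cube detector: orthogonality to every H-row, low members of any type `1,…,7`.**  `Z ⊔ A` an H-dependency with
`Z`-types in `{1,…,7}` and `A`-types in `{8,9}`; then for every point `s`, `#{(z,a) ∈ Z × A : z ∪ a ∈ 𝔊, z ∪ a ∪ s = univ}` is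
even. [this work] -/
theorem cube_detector_orthogonal_low (𝒯 : Finset (Finset α)) (θ : Finset α → ℕ)
    (hθ : ∀ s ∈ 𝒯, 1 ≤ θ s ∧ θ s ≤ 9)
    (hcov : ∀ s ∈ 𝒯, ∀ s' ∈ 𝒯, s ≠ s' → s ∪ s' ≠ univ)
    (𝔊 : Finset (Finset α)) (hG : ∀ g ∈ 𝔊, ∀ g' : Finset α, g ⊆ g' → g' ∈ 𝔊)
    (hHL : ∀ s ∈ 𝒯, ∀ s' ∈ 𝒯, hlOK (θ s) (θ s') = true → s ∪ s'ᶜ ∈ 𝔊)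
    (Z A : Finset (Finset α)) (hZ : Z ⊆ 𝒯) (hA : A ⊆ 𝒯)
    (hZt : ∀ z ∈ Z, 1 ≤ θ z ∧ θ z ≤ 7) (hAt : ∀ a ∈ A, θ a = 8 ∨ θ a = 9)
    (hdep : ∀ g ∈ 𝔊, ((#(Z.filter (fun y => y ⊆ g)) : ℕ) : ZMod 2) = ((#(A.filter (fun a => a ⊆ g)) : ℕ) : ZMod 2)) :
    ∀ s ∈ 𝒯, (∑ z ∈ Z, ∑ a ∈ A, (if z ∪ a ∈ 𝔊 ∧ z ∪ a ∪ s = univ then (1 : ZMod 2) else 0)) = 0 := by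
  intro s hs
  have hZA : Disjoint Z A := by
    rw [Finset.disjoint_left]; intro x hxZ hxA
    rcases hZt x hxZ with ⟨_, h7⟩; rcases hAt x hxA with h' | h' <;> omega
  -- drop the goodness condition: bad pairs are never covering
  have hdrop : (∑ z ∈ Z, ∑ a ∈ A, (if z ∪ a ∈ 𝔊 ∧ z ∪ a ∪ s = univ then (1 : ZMod 2) else 0))
      = ∑ z ∈ Z, ∑ a ∈ A, (if z ∪ a ∪ s = univ then (1 : ZMod 2) else 0) := by
    refine Finset.sum_congr rfl fun z hz => Finset.sum_congr rfl fun a ha => ?_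
    by_cases hza : z ∪ a ∈ 𝔊
    · by_cases hu : z ∪ a ∪ s = univ
      · rw [if_pos ⟨hza, hu⟩, if_pos hu]
      · rw [if_neg (fun h => hu h.2), if_neg hu]
    · rw [if_neg (fun h => hza h.1), if_neg (bad_pair_not_covered 𝒯 θ hθ 𝔊 hG hHL z (hZ hz) (hZt z hz).2 a (hA ha)
        (hAt a ha) hza s hs)]
  rw [hdrop]
  -- flipped dependency
  have hdep0 : ∀ g ∈ 𝔊, ((#((Z ∪ A).filter (fun ρ => ρ ⊆ g)) : ℕ) : ZMod 2) = 0 := by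
    intro g hg; rw [card_filter_union_cast Z A hZA, hdep g hg]; exact CharTwo.add_self_eq_zero _
  have hflip : ∀ g ∈ 𝔊, ((#(Z.filter (fun y => yᶜ ⊆ g)) : ℕ) : ZMod 2)
      = ((#(A.filter (fun a => aᶜ ⊆ g)) : ℕ) : ZMod 2) := by
    intro g hg
    have h0 := flip_even 𝔊 hG (Z ∪ A) hdep0 g hg
    rw [card_filter_union_cast Z A hZA] at h0
    have heq : ∀ x y : ZMod 2, x + y = 0 → x = y := by
      intro x y h; fin_cases x <;> fin_cases y <;> first | rfl | exact absurd h (by decide)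
    exact heq _ _ h0
  have hθs := hθ s hs
  by_cases hlow : θ s ≤ 7
  · -- orientation (P,Q) = (Z,A): a covering pair (z,a) makes s ∪ a good, via s ∪ zᶜ (z free) or a ∪ zᶜ (z not free)
    rw [cover_parity_core' 𝔊 Z A s hflip ?_ ?_]
    · have hempty : A.filter (fun a => a ∪ s = univ) = ∅ :=
        Finset.filter_eq_empty_iff.2 fun a ha h => hcov a (hA ha) s hs
          (fun has => by rcases hAt a ha with h8 | h9 <;> rw [has] at * <;> omega) h
      rw [hempty, Finset.card_empty, Nat.cast_zero]
    · intro a ha z hz hcover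
      have hzc : zᶜ ⊆ s ∪ a := (union3_eq_univ_iff z a s).1 hcover
      by_cases hzf : θ z = 5 ∨ θ z = 7
      · have hok : hlOK (θ s) (θ z) = true := hlOK_low_free _ _ ⟨hθs.1, hlow⟩ hzf
        exact hG _ (hHL s hs z (hZ hz) hok) _ (Finset.union_subset subset_union_left hzc)
      · have hok : hlOK (θ a) (θ z) = true := hlOK_anchor_low _ _ (hAt a ha) (hZt z hz) hzf
        exact hG _ (hHL a (hA ha) z (hZ hz) hok) _ (Finset.union_subset subset_union_right hzc)
    · intro a ha a' ha' hcover
      exact hG _ (hHL a (hA ha) a' (hA ha') (hlOK_anchor _ _ (hAt a ha) (hAt a' ha'))) _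
        (Finset.union_subset subset_union_right ((union3_eq_univ_iff a' a s).1 hcover))
  · -- θ s ∈ {8,9}: orientation (P,Q) = (A,Z)
    have h89 : θ s = 8 ∨ θ s = 9 := by omega
    rw [Finset.sum_comm]
    have hswap : (∑ a ∈ A, ∑ z ∈ Z, (if z ∪ a ∪ s = univ then (1 : ZMod 2) else 0))
        = ∑ a ∈ A, ∑ z ∈ Z, (if a ∪ z ∪ s = univ then (1 : ZMod 2) else 0) := by
      refine Finset.sum_congr rfl fun a _ => Finset.sum_congr rfl fun z _ => ?_
      rw [Finset.union_comm z a]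
    rw [hswap, cover_parity_core' 𝔊 A Z s (fun g hg => (hflip g hg).symm) ?_ ?_]
    · have hempty : Z.filter (fun z => z ∪ s = univ) = ∅ :=
        Finset.filter_eq_empty_iff.2 fun z hz h => hcov z (hZ hz) s hs
          (fun hzs => by rcases hZt z hz with ⟨_, h7⟩; rw [hzs] at h7; omega) h
      rw [hempty, Finset.card_empty, Nat.cast_zero]
    · intro z hz a ha hcover
      exact hG _ (hHL s hs a (hA ha) (hlOK_anchor _ _ h89 (hAt a ha))) _
        (Finset.union_subset subset_union_left ((union3_eq_univ_iff a z s).1 hcover))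
    · intro z hz z' hz' hcover
      have hzc : z'ᶜ ⊆ s ∪ z := (union3_eq_univ_iff z' z s).1 hcover
      by_cases hzf : θ z' = 5 ∨ θ z' = 7
      · -- z ∪ z'ᶜ is HL-good
        exact hG _ (hHL z (hZ hz) z' (hZ hz') (hlOK_low_free _ _ (hZt z hz) hzf)) _
          (Finset.union_subset subset_union_right hzc)
      · -- s ∪ z'ᶜ is HL-good (anchor row)
        exact hG _ (hHL s hs z' (hZ hz') (hlOK_anchor_low _ _ h89 (hZt z' hz') hzf)) _
          (Finset.union_subset subset_union_left hzc)

/-- **Cube detector against a free co-row, low members of any type `1,…,7`.**  For a free point `r` (type 5/7) not strictly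
inside any member of `Z`, `#{(z,a) ∈ Z × A : z ∪ a ∈ 𝔊, z ∪ a ∪ rᶜ = univ} ≡ [r ∈ Z]` (mod 2). [this work] -/
theorem cube_detector_corow_low (𝒯 : Finset (Finset α)) (θ : Finset α → ℕ)
    (𝔊 : Finset (Finset α)) (hG : ∀ g ∈ 𝔊, ∀ g' : Finset α, g ⊆ g' → g' ∈ 𝔊)
    (hHL : ∀ s ∈ 𝒯, ∀ s' ∈ 𝒯, hlOK (θ s) (θ s') = true → s ∪ s'ᶜ ∈ 𝔊)
    (hHH : ∀ s ∈ 𝒯, ∀ s' ∈ 𝒯, s ≠ s' → hhOK (θ s) (θ s') = true → s ∪ s' ∈ 𝔊)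
    (Z A : Finset (Finset α)) (hZ : Z ⊆ 𝒯) (hA : A ⊆ 𝒯)
    (hZt : ∀ z ∈ Z, 1 ≤ θ z ∧ θ z ≤ 7) (hAt : ∀ a ∈ A, θ a = 8 ∨ θ a = 9)
    (hdep : ∀ g ∈ 𝔊, ((#(Z.filter (fun y => y ⊆ g)) : ℕ) : ZMod 2) = ((#(A.filter (fun a => a ⊆ g)) : ℕ) : ZMod 2))
    (r : Finset α) (hr : r ∈ 𝒯) (hrt : θ r = 5 ∨ θ r = 7) (hmax : ∀ z ∈ Z, r ⊆ z → z = r) :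
    (∑ z ∈ Z, ∑ a ∈ A, (if z ∪ a ∈ 𝔊 ∧ z ∪ a ∪ rᶜ = univ then (1 : ZMod 2) else 0))
      = if r ∈ Z then 1 else 0 := by
  have hZA : Disjoint Z A := by
    rw [Finset.disjoint_left]; intro x hxZ hxA
    rcases hZt x hxZ with ⟨_, h7⟩; rcases hAt x hxA with h' | h' <;> omega
  -- a cross pair covering rᶜ contains r ∪ a, which is HH-good: no bad pair covers
  have hdrop : (∑ z ∈ Z, ∑ a ∈ A, (if z ∪ a ∈ 𝔊 ∧ z ∪ a ∪ rᶜ = univ then (1 : ZMod 2) else 0))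
      = ∑ z ∈ Z, ∑ a ∈ A, (if z ∪ a ∪ rᶜ = univ then (1 : ZMod 2) else 0) := by
    refine Finset.sum_congr rfl fun z hz => Finset.sum_congr rfl fun a ha => ?_
    by_cases hu : z ∪ a ∪ rᶜ = univ
    · have hra : r ⊆ z ∪ a := by
        have := (union_eq_univ_iff_compl_subset (z ∪ a) rᶜ).1 hu; rwa [compl_compl] at this
      have hne : r ≠ a := by
        intro h; rcases hrt with h5 | h7 <;> rcases hAt a ha with h8 | h9 <;> rw [h] at * <;> omega
      have hgood : z ∪ a ∈ 𝔊 := hG _ (hHH r hr a (hA ha) hne (hhOK_free_anchor _ _ hrt (hAt a ha))) _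
        (Finset.union_subset hra subset_union_right)
      rw [if_pos ⟨hgood, hu⟩, if_pos hu]
    · rw [if_neg (fun h => hu h.2), if_neg hu]
  rw [hdrop]
  have hdep0 : ∀ g ∈ 𝔊, ((#((Z ∪ A).filter (fun ρ => ρ ⊆ g)) : ℕ) : ZMod 2) = 0 := by
    intro g hg; rw [card_filter_union_cast Z A hZA, hdep g hg]; exact CharTwo.add_self_eq_zero _
  have hflip : ∀ g ∈ 𝔊, ((#(Z.filter (fun y => yᶜ ⊆ g)) : ℕ) : ZMod 2)
      = ((#(A.filter (fun a => aᶜ ⊆ g)) : ℕ) : ZMod 2) := by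
    intro g hg
    have h0 := flip_even 𝔊 hG (Z ∪ A) hdep0 g hg
    rw [card_filter_union_cast Z A hZA] at h0
    have heq : ∀ x y : ZMod 2, x + y = 0 → x = y := by
      intro x y h; fin_cases x <;> fin_cases y <;> first | rfl | exact absurd h (by decide)
    exact heq _ _ h0
  -- orientation (P,Q) = (A,Z): rᶜ ∪ z is HL-good for every z ∈ Z (all low rows contain the free types)
  rw [Finset.sum_comm]
  have hswap : (∑ a ∈ A, ∑ z ∈ Z, (if z ∪ a ∪ rᶜ = univ then (1 : ZMod 2) else 0))
      = ∑ a ∈ A, ∑ z ∈ Z, (if a ∪ z ∪ rᶜ = univ then (1 : ZMod 2) else 0) := by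
    refine Finset.sum_congr rfl fun a _ => Finset.sum_congr rfl fun z _ => ?_
    rw [Finset.union_comm z a]
  have hgoodz : ∀ z ∈ Z, rᶜ ∪ z ∈ 𝔊 := by
    intro z hz
    rw [Finset.union_comm]
    exact hHL z (hZ hz) r hr (hlOK_low_free _ _ (hZt z hz) hrt)
  rw [hswap, cover_parity_core' 𝔊 A Z rᶜ (fun g hg => (hflip g hg).symm)
    (fun z hz _ _ _ => hgoodz z hz) (fun z hz _ _ _ => hgoodz z hz)]
  -- the diagonal: z ∪ rᶜ = univ ↔ r ⊆ z ↔ z = r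
  have hfilt : Z.filter (fun z => z ∪ rᶜ = univ) = Z.filter (fun z => z = r) := by
    refine Finset.filter_congr fun z hz => ?_
    rw [union_eq_univ_iff_compl_subset z rᶜ, compl_compl]
    exact ⟨fun h => hmax z hz h, fun h => h ▸ subset_refl r⟩
  rw [hfilt]
  by_cases hrZ : r ∈ Z
  · rw [if_pos hrZ, Finset.filter_eq' Z r, if_pos hrZ, Finset.card_singleton, Nat.cast_one]
  · rw [if_neg hrZ, Finset.filter_eq' Z r, if_neg hrZ, Finset.card_empty, Nat.cast_zero]

end NineType

end Summit.CriticalPhenomena.PercolationContinuityZ3.Theorems
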